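import Summits.Ventures.MM22.Rank333.ProfileCertHeader
import HarnessLib

/-!
# MM22 venture — PROFILE-CERT kernel replay: the main soundness theorem

HONEST FRAMING (cell `pub-mm22`, seat p1 g5; V4-MENU item (0′) «kernel replay of the whole-root PROFILE-CERT»).
Checker PLUMBING with soundness theorems, written from the FROZEN format specification
`HOME/pub-mm22-p2/pcert/PROFILE-CERT-v1-frozen-20260822T2120Z.md` (sha256 59fc6c87…) only. The end declaration of the
chain (`ProfileCertGlue.rankGe21F2_of_pieces`) is an IMPLICATION whose antecedents are Wang's `Cert 3 3 3 [] 20`, a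
certified orbit table (Wang's printed values and the cell's 8 LP/LPDFS lifts), a passing singleton check and the
`NoExt` statement that the (not yet landed) data files assemble to. NOTHING here proves a bound on `R_𝔽₂(⟨3,3,3⟩)`;
no summit claim.

This file: `sem_chain`, `check_sound` (induction over the certificate tree), `noExt_of_check`, `St.WF_of_wfB`, `noExt_of_chunk`, `no_valid_of_noExt_init`.
-/

set_option autoImplicit false

namespace Summit.Ventures.MM22.ProfileCert

section Main0
open Finset
variable {rt : RT} {N : ℕ} {V : Finset ℕ → Prop}
/-- Chain nodes deliver `ChainNoExt` for their orbit list (given that the orbits are free and tidy). -/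
theorem sem_chain : ∀ (t : PC) (s : St), (∀ o ∈ t.orbits, ∀ f ∈ o, s.free f = true) →
    (∀ o ∈ t.orbits, o.Nodup) → t.orbits.Pairwise (fun o o' => ∀ f ∈ o, f ∉ o') →
    Sem V t s → ChainNoExt V t.orbits s
  | .scons o kid rest, s, hfree, hnd, hdisj, hsem => by
    obtain ⟨h1, h2⟩ := hsem
    have ho : o ∈ (PC.scons o kid rest).orbits := by simp [PC.orbits]
    have hsub : ∀ o' ∈ rest.orbits, o' ∈ (PC.scons o kid rest).orbits := fun o' ho' => by simp [PC.orbits, ho']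
    refine ⟨fun x₀ hx₀ => h1 x₀ hx₀ (hfree o ho x₀ (List.mem_of_mem_head? hx₀)), ?_⟩
    have hsem' := h2 (hfree o ho) (hnd o ho)
    have hdisj' := hdisj
    simp only [PC.orbits, List.pairwise_cons] at hdisj'
    refine sem_chain rest (s.setOutL o) (fun o' ho' f hf => ?_) (fun o' ho' => hnd o' (hsub o' ho')) hdisj'.2 hsem'
    rw [St.free_setOutL]
    exact ⟨hfree o' (hsub o' ho') f hf, fun hfo => hdisj'.1 o' ho' f hfo hf⟩
  | .slast _, s, _, _, _, hsem => hsem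
  | .c1 _, s, _, _, _, hsem => hsem
  | .c3 _, s, _, _, _, hsem => hsem
  | .c4, s, _, _, _, hsem => hsem
  | .c8 _ _, s, _, _, _, hsem => hsem
  | .seq _ _, s, _, _, _, hsem => hsem
  | .b _ _ _, s, _, _, _, hsem => hsem
  | .s _ _, s, _, _, _, hsem => hsem
  | .ref _, s, _, _, _, hsem => hsem

/-- **Main soundness theorem** (combinatorial form). -/
theorem check_sound (hV : VHyp0 rt N V) {refs : List Entry} (hrefs : RefsOK V refs) :
    ∀ (t : PC) (s : St), SymOKL V t.maps → s.WF → check rt N refs t s = true → Sem V t s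
  | .c1 rid, s, hy, hW, h => by
    simp only [check, decide_eq_true_eq] at h
    exact sound_c1 hV hW h
  | .c3 rid, s, hy, hW, h => by
    simp only [check, decide_eq_true_eq] at h
    exact sound_c3 hV hW h
  | .c4, s, hy, hW, h => by
    simp only [check, Bool.or_eq_true, decide_eq_true_eq] at h
    exact sound_c4 hV hW h
  | .c8 D ys, s, hy, hW, h => by
    simp only [check] at h
    exact sound_c8 hV hW h
  | .seq ss t, s, hy, hW, h => by
    simp only [check, Bool.and_eq_true, Bool.not_eq_true'] at h
    obtain ⟨ht, h⟩ := h
    split at h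
    · simp at h
    · rename_i s' hs'
      obtain ⟨hW', hE'⟩ := stepsRun_sound hV hW hs'
      have ih := (sem_iff_of_not_chain ht s').1 (check_sound hV hrefs t s' (hy.mono fun mp h => by simpa [PC.maps] using h) hW' h)
      show NoExt V s
      exact fun M hM hE => ih M hM (hE' M hM hE)
  | .b f tin tout, s, hy, hW, h => by
    simp only [check, Bool.and_eq_true, Bool.not_eq_true'] at h
    obtain ⟨⟨⟨⟨htin, htout⟩, hf⟩, h1⟩, h2⟩ := h
    have ih1 := (sem_iff_of_not_chain htin _).1 (check_sound hV hrefs tin (s.setIn f)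
      (hy.mono fun mp h => by simp [PC.maps, h]) (hW.setIn hf) h1)
    have ih2 := (sem_iff_of_not_chain htout _).1 (check_sound hV hrefs tout (s.setOut f)
      (hy.mono fun mp h => by simp [PC.maps, h]) (hW.setOut hf) h2)
    show NoExt V s
    intro M hM hE
    by_cases hfM : f ∈ M
    · exact ih1 M hM (hE.setIn_of_mem hfM)
    · exact ih2 M hM (hE.setOut_of_not_mem hfM)
  | .s maps body, s, hy, hW, h => by
    simp only [check, Bool.and_eq_true] at h
    obtain ⟨⟨_, hh⟩, hc⟩ := h
    have ih := check_sound hV hrefs body s (hy.mono fun mp h => by simp [PC.maps, h]) hW hc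
    obtain ⟨hσ, ho⟩ := header_facts (hy.mono fun mp h => by simp [PC.maps, h]) hW hh
    have hch := sem_chain body s ho.free ho.nodup ho.disj ih
    exact sound_orbits hV body.orbits s hW hσ ho hch
  | .scons o kid rest, s, hy, hW, h => by
    simp only [check, Bool.and_eq_true, Bool.not_eq_true'] at h
    obtain ⟨⟨⟨hkid, _⟩, h1⟩, h2⟩ := h
    refine ⟨fun x₀ hx₀ hfree => ?_, fun hfree hnd => ?_⟩
    · cases o with
      | nil => simp at hx₀
      | cons x os =>
        simp only [List.head?_cons, Option.some.injEq] at hx₀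
        subst hx₀
        exact (sem_iff_of_not_chain hkid _).1 (check_sound hV hrefs kid _
          (hy.mono fun mp h => by simp [PC.maps, h]) (hW.setIn hfree) h1)
    · exact check_sound hV hrefs rest _ (hy.mono fun mp h => by simp [PC.maps, h])
        (hW.setOutL o hfree hnd) h2
  | .slast kid, s, hy, hW, h => by
    simp only [check, Bool.and_eq_true, Bool.not_eq_true'] at h
    exact (sem_iff_of_not_chain h.1 _).1 (check_sound hV hrefs kid s
      (hy.mono fun mp h => by simpa [PC.maps] using h) hW h.2)
  | .ref k, s, hy, hW, h => by
    simp only [check] at h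
    split at h
    · simp at h
    · rename_i e he
      simp only [Bool.and_eq_true, decide_eq_true_eq] at h
      obtain ⟨⟨⟨h1, h2⟩, h3⟩, h4⟩ := h
      have := hrefs k e he
      show NoExt V s
      cases s
      simp only at h1 h2 h3 h4
      subst h1; subst h2; subst h3; subst h4
      exact this

/-- **Corollary**: an ordinary node that passes the check admits no valid extension. -/
theorem noExt_of_check (hV : VHyp rt N V) {refs : List Entry} (hrefs : RefsOK V refs) {t : PC}
    (ht : t.isChain = false) {s : St} (hW : s.WF) (h : check rt N refs t s = true) : NoExt V s :=
  (sem_iff_of_not_chain ht s).1 (check_sound hV.toVHyp0 hrefs t s (hV.sym.symOKL _) hW h)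

/-- **Corollary with listed symmetry only**: invariance is needed just for the generators the tree uses. -/
theorem noExt_of_check_maps (hV : VHyp0 rt N V) {refs : List Entry} (hrefs : RefsOK V refs) {t : PC}
    (hsym : SymOKL V t.maps) (ht : t.isChain = false) {s : St} (hW : s.WF) (h : check rt N refs t s = true) : NoExt V s :=
  (sem_iff_of_not_chain ht s).1 (check_sound hV hrefs t s hsym hW h)

/-- **Corollary without symmetry**: for certificates with no S-node only `VHyp0` is needed. -/
theorem noExt_of_check_noS (hV : VHyp0 rt N V) {refs : List Entry} (hrefs : RefsOK V refs) {t : PC}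
    (ht : t.isChain = false) (hn : t.noS = true) {s : St} (hW : s.WF) (h : check rt N refs t s = true) : NoExt V s :=
  noExt_of_check_maps hV hrefs (by rw [PC.maps_eq_nil_of_noS t hn]; intro mp hmp; simp at hmp) ht hW h


/-- Boolean well-formedness is enough. -/
theorem St.WF_of_wfB {s : St} (h : s.wfB = true) : s.WF := by
  unfold St.wfB at h
  simp only [Bool.and_eq_true, decide_eq_true_eq, List.all_eq_true, Bool.not_eq_true'] at h
  obtain ⟨⟨⟨⟨⟨hnd, hall⟩, hlt⟩, h0⟩, hnIn⟩, hnOut⟩ := h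
  refine ⟨hnd, fun f hf => isForm_iff.1 (hall f hf).1, fun f hf => (hall f hf).2, fun f hf => ?_, hnIn, ?_⟩
  · rw [mem_forms]
    constructor
    · cases f with
      | zero => rw [h0] at hf; exact Bool.noConfusion hf
      | succ f => exact Nat.succ_le_succ (Nat.zero_le f)
    · by_contra hle
      have hpow : 2 ^ (NF + 1) ≤ 2 ^ f := Nat.pow_le_pow_right (by decide) (by omega)
      rw [Nat.testBit_lt_two_pow (lt_of_lt_of_le hlt hpow)] at hf
      exact Bool.noConfusion hf
  · rw [hnOut, countUpTo_NF]
    unfold St.outSet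
    rfl

/-- **Per-chunk corollary** used by the assembly: a well-formed entry state whose (non-chain) certificate passes
admits no valid extension, given the referenced chunks' statements. -/
theorem noExt_of_chunk (hV : VHyp rt N V) {refs : List Entry} (hrefs : RefsOK V refs) {t : PC} {s : St}
    (ht : t.isChain = false) (hwf : s.wfB = true) (h : check rt N refs t s = true) : NoExt V s :=
  noExt_of_check hV hrefs ht (St.WF_of_wfB hwf) h

/-- **Per-chunk corollary without symmetry** (certificates with no S-node, e.g. p2's `-nosym` sub-instance files
replayed with entry state OUT := complement of the instance's form universe). -/
theorem noExt_of_chunk_noS (hV : VHyp0 rt N V) {refs : List Entry} (hrefs : RefsOK V refs) {t : PC} {s : St}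
    (ht : t.isChain = false) (hn : t.noS = true) (hwf : s.wfB = true) (h : check rt N refs t s = true) : NoExt V s :=
  noExt_of_check_noS hV hrefs ht hn (St.WF_of_wfB hwf) h

/-- **Per-chunk corollary with listed symmetry** (sub-instance certificates WITH S-nodes whose generators fix the instance). -/
theorem noExt_of_chunk_maps (hV : VHyp0 rt N V) {refs : List Entry} (hrefs : RefsOK V refs) {t : PC} {s : St}
    (hsym : SymOKL V t.maps) (ht : t.isChain = false) (hwf : s.wfB = true) (h : check rt N refs t s = true) : NoExt V s :=
  noExt_of_check_maps hV hrefs hsym ht (St.WF_of_wfB hwf) h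

/-- **Top-level form**: at the initial state (nothing IN, nothing OUT) `NoExt` says no valid set exists at all. -/
theorem no_valid_of_noExt_init (h : NoExt V ⟨[], 0, 0, 0⟩) : ∀ M, V M → False :=
  fun M hM => h M hM ⟨fun _ hf => by simp at hf, fun _ _ => Nat.zero_testBit _⟩


end Main0

end Summit.Ventures.MM22.ProfileCert
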